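import Mathlib
import HarnessLib

/-!
# Finite local energy of a discretely self-similar cone at the Onsager-critical homogeneity

Analysis/FluidPDE support file (companion of `SelfSimilarEulerConeFlux`). For a field
`V : ℝ³ → ℝ³` that is discretely self-similar of degree `-2/3` under ONE dilation `λ > 1`,
`V (λx) = λ^{-2/3} V x` for `x ≠ 0`, and whose energy density `|V|²` is locally integrable off the
origin, the energy density is integrable on the unit ball: the shell energies
`∫_{(λ^{k+1})⁻¹ < ‖x‖ ≤ (λ^k)⁻¹} |V|² = λ^{-5k/3} ∫_{λ⁻¹ < ‖x‖ ≤ 1} |V|²` form a geometric series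
(`3 - 4/3 = 5/3 > 0`: the critical cone has finite energy at its tip, although `V ∼ |x|^{-2/3}` is
unbounded there). This is the `L²`-germ property of DSS far fields / point-sink profiles used by the
anomalous-dissipation summit (route PointSink: `MemLp U 2` for a velocity equal to the cone near the
sink), recorded here once as plain measure theory.

* `DSSCone.velocity_inv_smul`, `DSSCone.normSq_inv_pow_smul` — backward and iterated
  self-similarity   `‖V ((λ^k)⁻¹ y)‖² = (λ^k)^{4/3} ‖V y‖²` off the origin;
* `DSSCone.ball_subset_iUnion_shell` — the punctured unit ball is covered by the `λ`-adic shells;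
* `DSSCone.normSq_integrableOn_ball` — `IntegrableOn (fun x => ‖V x‖ ^ 2) (ball 0 1)`.

## Mathlib / tree search

Mathlib (this pin): `Measure.setIntegral_comp_smul_of_pos` (dilation of set integrals),
`integrableOn_iUnion_of_summable_integral_norm`, `summable_geometric_of_lt_one`,
`pow_unbounded_of_one_lt`; nothing on self-similar fields. Tree: `SelfSimilar*.lean` (parabolic
Leray self-similarity, different scaling), `HomogeneousEuler.lean` (continuous homogeneity, `C¹`);
no discrete-self-similarity energy lemma (searched `lam ^ (-(2 / 3`, `self-similar`, `shell`).
No definitions, no named facts.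

## References

* R. Shvydkoy, *Homogeneous solutions to the 3D Euler system*, Trans. Amer. Math. Soc. 370 (2018)
  2517–2535, §1 (the locally-finite-energy threshold `α < 3/2` for `|x|^{-α}` profiles; here
  `α = 2/3`). [`Shvydkoy2018`]
-/

noncomputable section

open MeasureTheory Filter Topology Set Metric
open scoped Pointwise

namespace Literature.Analysis.FluidPDE

namespace DSSCone

/-- Physical space `ℝ³`. -/
local notation "ℝ³" => EuclideanSpace ℝ (Fin 3)

/-- Backward form of discrete self-similarity: `V (λ⁻¹ y) = λ^{2/3} V y` off the origin (copy of
`DSSEulerCone.velocity_inv_smul`, kept here so that the two files are independent). [folklore] -/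
theorem velocity_inv_smul {lam : ℝ} {V : ℝ³ → ℝ³} (hlam : 1 < lam)
    (hDSS : ∀ x : ℝ³, x ≠ 0 → V (lam • x) = lam ^ (-(2 / 3 : ℝ)) • V x) {y : ℝ³} (hy : y ≠ 0) :
    V (lam⁻¹ • y) = lam ^ (2 / 3 : ℝ) • V y := by
  have hlam0 : (0 : ℝ) < lam := by linarith
  have hy' : lam⁻¹ • y ≠ 0 := by
    simpa [smul_eq_zero, inv_eq_zero, hlam0.ne'] using hy
  have h := hDSS (lam⁻¹ • y) hy'
  rw [smul_smul, mul_inv_cancel₀ hlam0.ne', one_smul] at h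
  rw [h, smul_smul, ← Real.rpow_add hlam0]
  norm_num


/-- Iterated backward self-similarity of the energy density:
`‖V ((λ^k)⁻¹ y)‖² = (λ^k)^{4/3} ‖V y‖²` off the origin. [folklore] -/
theorem normSq_inv_pow_smul {lam : ℝ} {V : ℝ³ → ℝ³} (hlam : 1 < lam)
    (hDSS : ∀ x : ℝ³, x ≠ 0 → V (lam • x) = lam ^ (-(2 / 3 : ℝ)) • V x) (k : ℕ) {y : ℝ³}
    (hy : y ≠ 0) : ‖V ((lam ^ k)⁻¹ • y)‖ ^ 2 = (lam ^ k) ^ (4 / 3 : ℝ) * ‖V y‖ ^ 2 := by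
  have hlam0 : (0 : ℝ) < lam := by linarith
  induction k with
  | zero => simp
  | succ k ih =>
    have hz : (lam ^ k)⁻¹ • y ≠ 0 := by
      simpa [smul_eq_zero, inv_eq_zero, pow_ne_zero _ hlam0.ne'] using hy
    rw [show lam ^ (k + 1) = lam ^ k * lam from pow_succ lam k, mul_inv_rev, mul_smul,
      velocity_inv_smul hlam hDSS hz, norm_smul, mul_pow, ih,
      Real.norm_of_nonneg (Real.rpow_nonneg hlam0.le _), ← Real.rpow_natCast,
      ← Real.rpow_mul hlam0.le, Real.mul_rpow (pow_nonneg hlam0.le _) hlam0.le]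
    norm_num
    ring

/-- The punctured unit ball is covered by the shells `A_k`. [folklore] -/
theorem ball_subset_iUnion_shell {lam : ℝ} (hlam : 1 < lam) :
    ball (0 : ℝ³) 1 ⊆ {0} ∪ ⋃ k : ℕ, {x : ℝ³ | (lam ^ (k + 1))⁻¹ < ‖x‖ ∧ ‖x‖ ≤ (lam ^ k)⁻¹} := by
  intro x hx
  by_cases hx0 : x = 0
  · exact Or.inl hx0
  right
  have hxn : 0 < ‖x‖ := norm_pos_iff.2 hx0
  have hx1 : ‖x‖ < 1 := by simpa using hx
  have hex : ∃ k : ℕ, (lam ^ (k + 1))⁻¹ < ‖x‖ := by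
    obtain ⟨n, hn⟩ := pow_unbounded_of_one_lt ‖x‖⁻¹ hlam
    refine ⟨n, ?_⟩
    have h1 : ‖x‖⁻¹ < lam ^ (n + 1) := hn.trans_le (pow_le_pow_right₀ hlam.le (Nat.le_succ n))
    rwa [inv_lt_comm₀ (by positivity) hxn]
  classical
  refine mem_iUnion.2 ⟨Nat.find hex, Nat.find_spec hex, ?_⟩
  rcases h : Nat.find hex with _ | m
  · simpa using hx1.le
  · have hm : ¬ (lam ^ (m + 1))⁻¹ < ‖x‖ := Nat.find_min hex (by rw [h]; exact Nat.lt_succ_self m)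
    exact not_lt.1 hm

/-- **The DSS cone is square integrable on the unit ball.** If `V` is discretely self-similar of
degree `-2/3` (`λ > 1`) and `|V|²` is locally integrable off the origin, then `|V|² ∈ L¹(B₁)`:
the shell energies `∫_{A_k} |V|² = λ^{-5k/3} ∫_{A_0} |V|²` form a geometric series (this is the
`L²`-germ clause `MemLp U 2` of the scaffold near the sink, and the reason the sink has finite
energy at the Onsager-critical homogeneity). [folklore] -/
theorem normSq_integrableOn_ball {lam : ℝ} {V : ℝ³ → ℝ³} (hlam : 1 < lam)
    (hDSS : ∀ x : ℝ³, x ≠ 0 → V (lam • x) = lam ^ (-(2 / 3 : ℝ)) • V x)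
    (hVloc : LocallyIntegrableOn (fun x => ‖V x‖ ^ 2) {x : ℝ³ | x ≠ 0} volume) :
    IntegrableOn (fun x => ‖V x‖ ^ 2) (ball (0 : ℝ³) 1) volume := by
  have hlam0 : (0 : ℝ) < lam := by linarith
  set g : ℝ³ → ℝ := fun x => ‖V x‖ ^ 2 with hg_def
  set A : ℕ → Set ℝ³ := fun k => {x : ℝ³ | (lam ^ (k + 1))⁻¹ < ‖x‖ ∧ ‖x‖ ≤ (lam ^ k)⁻¹}
    with hA_def
  have hmemA : ∀ k x, x ∈ A k ↔ (lam ^ (k + 1))⁻¹ < ‖x‖ ∧ ‖x‖ ≤ (lam ^ k)⁻¹ := fun k x => by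
    simp only [hA_def, mem_setOf_eq]
  -- integrability on each shell
  have hshell : ∀ k, IntegrableOn g (A k) volume := by
    intro k
    have hK : IsCompact {x : ℝ³ | (lam ^ (k + 1))⁻¹ ≤ ‖x‖ ∧ ‖x‖ ≤ (lam ^ k)⁻¹} := by
      refine Metric.isCompact_of_isClosed_isBounded ?_ ?_
      · exact (isClosed_le continuous_const continuous_norm).inter
          (isClosed_le continuous_norm continuous_const)
      · exact (isBounded_closedBall (x := (0 : ℝ³)) (r := (lam ^ k)⁻¹)).subset
          fun x hx => by simpa using hx.2
    have hKsub : {x : ℝ³ | (lam ^ (k + 1))⁻¹ ≤ ‖x‖ ∧ ‖x‖ ≤ (lam ^ k)⁻¹} ⊆ {x : ℝ³ | x ≠ 0} := by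
      intro x hx h0
      have h1 : (0 : ℝ) < (lam ^ (k + 1))⁻¹ := by positivity
      have h2 : (lam ^ (k + 1))⁻¹ ≤ ‖x‖ := hx.1
      rw [h0, norm_zero] at h2
      linarith
    exact (hVloc.integrableOn_compact_subset hKsub hK).mono_set fun x hx =>
      ⟨((hmemA k x).1 hx).1.le, ((hmemA k x).1 hx).2⟩
  -- the shell energies scale geometrically
  have hscale : ∀ k, ∫ x in A k, g x =
      ((lam ^ k) ^ 3)⁻¹ * (lam ^ k) ^ (4 / 3 : ℝ) * ∫ x in A 0, g x := by
    intro k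
    have hR : (0 : ℝ) < lam ^ k := pow_pos hlam0 k
    set G : ℝ³ → ℝ := fun y => g ((lam ^ k)⁻¹ • y) with hG_def
    have h1 : ∀ x, g x = G (lam ^ k • x) := fun x => by
      simp [hG_def, smul_smul, inv_mul_cancel₀ hR.ne']
    have hset : lam ^ k • A k = A 0 := by
      ext y
      rw [Set.mem_smul_set_iff_inv_smul_mem₀ hR.ne']
      simp only [hmemA, norm_smul, norm_inv, Real.norm_of_nonneg hR.le,
        pow_zero, inv_one, zero_add, pow_succ, mul_inv_rev]
      rw [mul_one, mul_comm lam⁻¹, mul_lt_mul_iff_of_pos_left (inv_pos.2 hR),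
        mul_le_iff_le_one_right (inv_pos.2 hR)]
    have hL : ∫ x in A k, g x = ∫ x in A k, G (lam ^ k • x) :=
      integral_congr_ae (Eventually.of_forall h1)
    rw [hL, Measure.setIntegral_comp_smul_of_pos volume G (A k) hR, hset,
      finrank_euclideanSpace_fin, smul_eq_mul]
    have h2 : ∫ y in A 0, G y = (lam ^ k) ^ (4 / 3 : ℝ) * ∫ y in A 0, g y := by
      rw [← integral_const_mul]
      refine setIntegral_congr_fun ?_ fun y hy => ?_
      · rw [hA_def]
        exact (measurableSet_lt measurable_const measurable_norm).inter
          (measurableSet_le measurable_norm measurable_const)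
      · have hy0 : y ≠ 0 := by
          intro h0
          have h3 : (0 : ℝ) < (lam ^ (0 + 1))⁻¹ := by positivity
          have h4 : (lam ^ (0 + 1))⁻¹ < ‖y‖ := ((hmemA 0 y).1 hy).1
          rw [h0, norm_zero] at h4
          linarith
        exact normSq_inv_pow_smul hlam hDSS k hy0
    rw [h2, mul_assoc]
  -- the ratio of the series
  have hq : ∀ k : ℕ, ((lam ^ k) ^ 3)⁻¹ * (lam ^ k) ^ (4 / 3 : ℝ) = (lam ^ (-(5 / 3 : ℝ))) ^ k := by
    intro k
    have hk0 : (0 : ℝ) ≤ lam ^ k := (pow_pos hlam0 k).le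
    rw [show ((lam ^ k) ^ 3 : ℝ) = (lam ^ k) ^ (3 : ℝ) by
        rw [show (3 : ℝ) = ((3 : ℕ) : ℝ) by norm_num, Real.rpow_natCast],
      ← Real.rpow_neg hk0, ← Real.rpow_add (pow_pos hlam0 k), ← Real.rpow_natCast,
      ← Real.rpow_mul hlam0.le, ← Real.rpow_natCast, ← Real.rpow_mul hlam0.le]
    norm_num
    ring_nf
  have hq1 : lam ^ (-(5 / 3 : ℝ)) < 1 := Real.rpow_lt_one_of_one_lt_of_neg hlam (by norm_num)
  have hq0 : 0 ≤ lam ^ (-(5 / 3 : ℝ)) := Real.rpow_nonneg hlam0.le _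
  -- assemble
  have hunion : IntegrableOn g (⋃ k, A k) volume := by
    refine integrableOn_iUnion_of_summable_integral_norm hshell ?_
    have hnorm : ∀ k, ∫ x in A k, ‖g x‖ = ∫ x in A k, g x := fun k =>
      integral_congr_ae (Eventually.of_forall fun x => Real.norm_of_nonneg (sq_nonneg _))
    have hterm : (fun k => ∫ x in A k, ‖g x‖) =
        fun k => (lam ^ (-(5 / 3 : ℝ))) ^ k * ∫ x in A 0, g x := by
      funext k
      rw [hnorm k, hscale k, hq k]
    rw [hterm]
    exact (summable_geometric_of_lt_one hq0 hq1).mul_right _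
  have hzero : IntegrableOn g ({0} : Set ℝ³) volume := by
    rw [IntegrableOn, Measure.restrict_eq_zero.2 (measure_singleton _)]
    exact integrable_zero_measure
  have hcover : ball (0 : ℝ³) 1 ⊆ {0} ∪ ⋃ k, A k := by
    rw [hA_def]
    exact ball_subset_iUnion_shell hlam
  exact (hzero.union hunion).mono_set hcover

end DSSCone

end Literature.Analysis.FluidPDE

end
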